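import Mathlib
import Summits.ResolutionOfSingularities.ResolutionOfSingularities.Theorems.WildQuotientsWildQuotientResolutionBlowupLocalExitQuotient

/-!
# Closed sets downstairs for THREE charts of `X/G` (V4U: the two singular lines of `Bl_{I₆}𝔸⁴/σ`)

Crux stmt-ResolutionOfSingularities-15640 (`WildQuotients.WildQuotientResolution`), line `Sketch`;
chain w45c, programme V4U (res-L1-w45c-stub-3, EXIT-ASSEMBLY-MAP). [OURS · L1 W4.5c] — generic
glue, NOT a statement of the manuscript.

The two-chart lemmas `isClosed_image_gluedι` / `isClosed_gluedMk_image` /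
`exists_closeds_image_gluedMk` (p485627, p492084) need the two stable opens to COVER `X`. In V4U the
centre downstairs is the image of a closed `T ⊆ X` lying in ONE of THREE covering stable opens and
missing the other two (each singular line of `V = Bl_{I₆}𝔸⁴` lies in its own vertex chart only):

* `isClosed_image_gluedι₃` — a closed subset of the chart `O₀/G` whose image misses the charts
  `O₁/G`, `O₂/G` has closed image in `X/G` when the three charts cover;
* `isClosed_gluedMk_image₃`, `exists_closeds_image_gluedMk₃` — the image of a closed `T ⊆ O₀`
  with `T ∩ O₁ = T ∩ O₂ = ∅` is a `Closeds` of `X/G` missing the charts `O₁/G` and `O₂/G`;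
* `exists_closeds_union₃` — for V4U's `Z = Z₀ ∪ Z₁` (`T₀ ⊆ O₀`, `T₁ ⊆ O₁`, both missing the terminal
  chart `O₂`): a `Closeds` equal to `π(T₀) ∪ π(T₁)` and missing `O₂/G` — the `Z, hZ₂` of
  `hasResolution_glued_of_three_pieces`.
-/

-- single-problem summit: the doubled namespace component `ResolutionOfSingularities` is forced
set_option linter.dupNamespace false

noncomputable section

universe u

open CategoryTheory AlgebraicGeometry TopologicalSpace
open Literature.AlgebraicGeometry.Resolution Literature.AlgebraicGeometry.RelativeSpec

namespace Summit.ResolutionOfSingularities.ResolutionOfSingularities.Theorems.WildQuotientResolution.BlowupExit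

variable {X S : Scheme.{u}} {r : X ⟶ S} {G : Type u} [Group G] [Finite G]
  (ρ : ActionOver r G) [S.IsSeparated] [IsSeparated r]

/-- **A closed subset of the chart `O₀/G` whose image misses the charts `O₁/G` and `O₂/G` has
closed image in `X/G`**, when the three charts cover. [folklore] -/
theorem isClosed_image_gluedι₃ (hcov : ∀ x : X, ∃ O : ρ.StableAffineOpens, x ∈ O.1)
    (O₀ O₁ O₂ : ρ.StableAffineOpens) (h : O₀.1 ⊔ O₁.1 ⊔ O₂.1 = ⊤)
    (Z₀ : Set (ρ.pieceQuot O₀)) (hZ₀ : IsClosed Z₀)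
    (hd₁ : Disjoint ((ρ.gluedι O₀).base '' Z₀) ((ρ.gluedι O₁).opensRange : Set ρ.glued))
    (hd₂ : Disjoint ((ρ.gluedι O₀).base '' Z₀) ((ρ.gluedι O₂).opensRange : Set ρ.glued)) :
    IsClosed ((ρ.gluedι O₀).base '' Z₀) := by
  have hcovU := opensRange_gluedι_sup₃_eq_top ρ hcov O₀ O₁ O₂ h
  have hinj : Function.Injective (ρ.gluedι O₀).base := (ρ.gluedι O₀).isOpenEmbedding.injective
  have hc : ((ρ.gluedι O₀).base '' Z₀)ᶜ =
      (ρ.gluedι O₀).base '' Z₀ᶜ ∪ ((ρ.gluedι O₁).opensRange : Set ρ.glued) ∪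
        ((ρ.gluedι O₂).opensRange : Set ρ.glued) := by
    ext z
    constructor
    · intro hz
      have hz' : z ∈ (ρ.gluedι O₀).opensRange ⊔ (ρ.gluedι O₁).opensRange ⊔
          (ρ.gluedι O₂).opensRange := by
        rw [hcovU]
        exact Opens.mem_top z
      rcases Opens.mem_sup.mp hz' with hz' | h2
      · rcases Opens.mem_sup.mp hz' with ⟨q, rfl⟩ | h1
        · exact Or.inl (Or.inl ⟨q, fun hq => hz ⟨q, hq, rfl⟩, rfl⟩)
        · exact Or.inl (Or.inr h1)
      · exact Or.inr h2
    · rintro ((⟨q, hq, rfl⟩ | h1) | h2) hz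
      · obtain ⟨q', hq', e⟩ := hz
        rw [hinj e] at hq'
        exact hq hq'
      · exact Set.disjoint_right.mp hd₁ h1 hz
      · exact Set.disjoint_right.mp hd₂ h2 hz
  rw [← isOpen_compl_iff, hc]
  exact (((ρ.gluedι O₀).isOpenEmbedding.isOpenMap _ hZ₀.isOpen_compl).union
    (ρ.gluedι O₁).opensRange.isOpen).union (ρ.gluedι O₂).opensRange.isOpen

/-- **The image in `X/G` of a closed `T ⊆ X` lying in the stable open `O₀` and missing the stable
opens `O₁, O₂`, `O₀ ∪ O₁ ∪ O₂ = X`, is closed in `X/G` and misses the charts `O₁/G`, `O₂/G`.**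
[folklore] -/
theorem isClosed_gluedMk_image₃ (hcov : ∀ x : X, ∃ O : ρ.StableAffineOpens, x ∈ O.1)
    (O₀ O₁ O₂ : ρ.StableAffineOpens) (h : O₀.1 ⊔ O₁.1 ⊔ O₂.1 = ⊤)
    (T : Set X) (hT : IsClosed T) (hT₀ : T ⊆ (O₀.1 : Set X))
    (hT₁ : Disjoint T (O₁.1 : Set X)) (hT₂ : Disjoint T (O₂.1 : Set X)) :
    IsClosed ((ρ.gluedMk hcov).base '' T) ∧
      Disjoint ((ρ.gluedMk hcov).base '' T) ((ρ.gluedι O₁).opensRange : Set ρ.glued) ∧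
      Disjoint ((ρ.gluedMk hcov).base '' T) ((ρ.gluedι O₂).opensRange : Set ρ.glued) := by
  have hd₁ := gluedMk_image_disjoint_opensRange ρ hcov T O₁ hT₁
  have hd₂ := gluedMk_image_disjoint_opensRange ρ hcov T O₂ hT₂
  refine ⟨?_, hd₁, hd₂⟩
  let T₀ : Set (O₀.1 : Scheme.{u}) := O₀.1.ι.base ⁻¹' T
  have hT₀c : IsClosed T₀ := hT.preimage O₀.1.ι.continuous
  have himg : (ρ.gluedMk hcov).base '' T =
      (ρ.gluedι O₀).base '' ((ρ.pieceMk O₀).base '' T₀) := by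
    ext z
    constructor
    · rintro ⟨x, hxT, rfl⟩
      refine ⟨(ρ.pieceMk O₀).base ⟨x, hT₀ hxT⟩, ⟨⟨x, hT₀ hxT⟩, ?_, rfl⟩, ?_⟩
      · change (O₀.1.ι.base ⟨x, hT₀ hxT⟩) ∈ T
        exact hxT
      · exact (ρ.gluedMk_apply hcov O₀ ⟨x, hT₀ hxT⟩).symm
    · rintro ⟨_, ⟨x, hx, rfl⟩, rfl⟩
      exact ⟨x.1, hx, ρ.gluedMk_apply hcov O₀ x⟩
  rw [himg]
  refine isClosed_image_gluedι₃ ρ hcov O₀ O₁ O₂ h _ (isClosedMap_pieceMk ρ O₀ _ hT₀c) ?_ ?_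
  · rw [← himg]; exact hd₁
  · rw [← himg]; exact hd₂

/-- The same packaged as a `Closeds` of `X/G`. [folklore] -/
theorem exists_closeds_image_gluedMk₃ (hcov : ∀ x : X, ∃ O : ρ.StableAffineOpens, x ∈ O.1)
    (O₀ O₁ O₂ : ρ.StableAffineOpens) (h : O₀.1 ⊔ O₁.1 ⊔ O₂.1 = ⊤)
    (T : Set X) (hT : IsClosed T) (hT₀ : T ⊆ (O₀.1 : Set X))
    (hT₁ : Disjoint T (O₁.1 : Set X)) (hT₂ : Disjoint T (O₂.1 : Set X)) :
    ∃ Z : Closeds ρ.glued, (Z : Set ρ.glued) = (ρ.gluedMk hcov).base '' T ∧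
      Disjoint (Set.range (ρ.gluedι O₁).base) (Z : Set ρ.glued) ∧
      Disjoint (Set.range (ρ.gluedι O₂).base) (Z : Set ρ.glued) := by
  obtain ⟨hcl, hd₁, hd₂⟩ := isClosed_gluedMk_image₃ ρ hcov O₀ O₁ O₂ h T hT hT₀ hT₁ hT₂
  exact ⟨⟨_, hcl⟩, rfl, hd₁.symm, hd₂.symm⟩

/-- **V4U's centre downstairs**: `T₀ ⊆ O₀` and `T₁ ⊆ O₁` closed, each missing the other two
stable opens; then `π(T₀) ∪ π(T₁)` is a `Closeds` of `X/G` missing the chart `O₂/G` (the `Z, hZ₂`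
of `hasResolution_glued_of_three_pieces`). [folklore] -/
theorem exists_closeds_union₃ (hcov : ∀ x : X, ∃ O : ρ.StableAffineOpens, x ∈ O.1)
    (O₀ O₁ O₂ : ρ.StableAffineOpens) (h : O₀.1 ⊔ O₁.1 ⊔ O₂.1 = ⊤)
    (T₀ T₁ : Set X) (hT₀c : IsClosed T₀) (hT₁c : IsClosed T₁)
    (h₀₀ : T₀ ⊆ (O₀.1 : Set X)) (h₀₁ : Disjoint T₀ (O₁.1 : Set X)) (h₀₂ : Disjoint T₀ (O₂.1 : Set X))
    (h₁₁ : T₁ ⊆ (O₁.1 : Set X)) (h₁₀ : Disjoint T₁ (O₀.1 : Set X)) (h₁₂ : Disjoint T₁ (O₂.1 : Set X)) :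
    ∃ Z : Closeds ρ.glued,
      (Z : Set ρ.glued) = (ρ.gluedMk hcov).base '' T₀ ∪ (ρ.gluedMk hcov).base '' T₁ ∧
      Disjoint (Set.range (ρ.gluedι O₂).base) (Z : Set ρ.glued) := by
  obtain ⟨Z₀, hZ₀, -, hZ₀₂⟩ := exists_closeds_image_gluedMk₃ ρ hcov O₀ O₁ O₂ h T₀ hT₀c h₀₀ h₀₁ h₀₂
  -- for `T₁` reorder the cover as `O₁, O₀, O₂`
  have h' : O₁.1 ⊔ O₀.1 ⊔ O₂.1 = ⊤ := by rw [sup_comm O₁.1, h]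
  obtain ⟨Z₁, hZ₁, -, hZ₁₂⟩ := exists_closeds_image_gluedMk₃ ρ hcov O₁ O₀ O₂ h' T₁ hT₁c h₁₁ h₁₀ h₁₂
  refine ⟨Z₀ ⊔ Z₁, ?_, ?_⟩
  · rw [Closeds.coe_sup, hZ₀, hZ₁]
  · rw [Closeds.coe_sup]
    exact Disjoint.union_right hZ₀₂ hZ₁₂

end Summit.ResolutionOfSingularities.ResolutionOfSingularities.Theorems.WildQuotientResolution.BlowupExit

end
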